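import Mathlib
import HarnessLib
import Summits.HubbardSuperconductivity.HubbardSuperconductivity.Theorems.KLProgrammeKLRegimeEngineScaleZeroE1Order
import Summits.HubbardSuperconductivity.HubbardSuperconductivity.Theorems.KLProgrammeKLRegimeEngineScaleZeroE1Theta
import Summits.HubbardSuperconductivity.HubbardSuperconductivity.Theorems.KLProgrammeKLRegimeEngineScaleZeroE1CE
import Summits.HubbardSuperconductivity.HubbardSuperconductivity.Theorems.KLProgrammeKLRegimeEngineScaleZeroE1Regime
import Summits.HubbardSuperconductivity.HubbardSuperconductivity.Theorems.KLProgrammeKLRegimeEngineScaleZeroValuesExplicit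

/-!
# K3 engine child (stmt-HubbardSuperconductivity-19855), stub `stub_engine_scale0`: clause (E1-v4)₀ `KernelNormsV4 … 0` CLOSED for every
# admissible frame, modulo two package numbers

Cell gate-hubbard-kl, seat hubbard-kl-k3c2-p1 (engine skeleton owner).  The scale-`0` kernel-norm clause of `stub_engine_scale0`,
`KernelNormsV4 L M P Q β U μ K 0` (`∀ p ≥ 2, ‖W^{(0),a}_{2p}‖ ≤ Q.CE^p·(Klam·(|U| + U²·0))^{p-1}·2^{(3p-5)·0}`), from the ENGINE's binders
(`FrameOK R U N μ K`, `R.WF`, `μ ∈ klWindowC`, `0 < U ≤ 1`, `klBetaMin ≤ β`, `klEngL₃ β U ≤ L`, `klEngM₃ β U L ≤ M`) and exactly TWO package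
conditions — the smallness `klScaleZeroThetaC R · U ≤ 1/2` (the SAME number p3 g6's values clause `pairLadderStepAtV8_zero_of_klEng` uses)
together with `(16/15)·Gfr0·|U| ≤ 1/50`, and the size `klE1CEBound R P ≤ Q.CE` spelled out below — by:
`klAnisoLegKernelNorm_zero_le_order` (this seat: bi-graded DB step ∘ grid overlap ∘ p3's symbol layer ∘ k3c4-p2's decay) at
`A₀ := klScaleZeroA0` (`rowSum/colSum_scaleZero_le_A0`, p3 g6), `kK := klKappaFrameC R·|U|` (`sum_norm_framePosKernel_le_linear_of_frameOK`,
p3 g6), `θ = klScaleZeroThetaC R·|U|` (`theta_scaleZero_eq`), the regime sizes (`scaleZero_regime_sizes`) and `orderBound_le_CE_pow`.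

* **`kernelNormsV4_zero_of_klEng`**.

Everything is proved; no definitions (the CE threshold is written out), no named facts, no sorry.
-/

noncomputable section

namespace Summit.HubbardSuperconductivity.HubbardSuperconductivity.Theorems.EngineV8

set_option linter.dupNamespace false -- summit = problem name (single-conjunct summit), D-0017

open Real Finset Literature.MathematicalPhysics.QuantumLattice Literature.Probability.LatticeModels
open Summit.HubbardSuperconductivity.HubbardSuperconductivity.Theorems.KLRegimeSplit
open Summit.HubbardSuperconductivity.HubbardSuperconductivity.Theorems.KLProgrammeLegKernels
open Summit.HubbardSuperconductivity.HubbardSuperconductivity.Theorems.ScaleZeroDecay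

variable {L M : ℕ} [NeZero L]

/-- **(E1-v4)₀ — `KernelNormsV4 … 0` on every admissible frame.**  Package conditions: `klScaleZeroThetaC R·U ≤ 1/2`,
`(16/15)Gfr0·|U| ≤ 1/50`, and `Q.CE ≥ B·max(1,X)·max(1,Y)·max(1,Klam⁻¹)` with `B = 2C_T²/κ₀²`, `X = 16e⁹κ₀²·klScaleZeroA0`, `Y = 4e⁹κ₀⁴`
(`κ₀² = 2·6054`, `C_T` the closed form of `klAnisoLegKernelNorm_zero_le_order`). -/
theorem kernelNormsV4_zero_of_klEng [NeZero M] {R : RenConsts} (hR : R.WF) {U : ℝ} (hU : 0 < U) (hU1 : U ≤ 1)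
    {N : ℕ} {μ : ℝ} {K : TrigPolyC4v} (hK : FrameOK R U N μ K) (hμ : μ ∈ klWindowC)
    (hκU : 16 / 15 * (R.Gfr 0 * |U|) ≤ 1 / 50) {β : ℝ} (hβ : klBetaMin ≤ β)
    (hL : klEngL₃ β U ≤ L) (hM : klEngM₃ β U L ≤ M) (hθ : klScaleZeroThetaC R * U ≤ 1 / 2)
    {P : SplitConsts} (hP : 0 < P.Klam) {Q : EngConsts}
    (hQ : 2 * (Real.sqrt (2048 * (16 * Real.pi / klE0 + 1) *
            (4 * ((2 * Real.sqrt 2 / (2 / (Real.pi * ((22484224 / 9 + 7180 / 3 * sectorCircLineConst) + 1))) + 2) *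
              (2 * Real.sqrt 2 / (2 / (Real.pi * ((22484224 / 9 + 7180 / 3 * sectorCircLineConst) + 1))) + 2)) +
              16 * (1 / (2 / (Real.pi * ((22484224 / 9 + 7180 / 3 * sectorCircLineConst) + 1))) + 1) ^ 2)) *
          Real.sqrt (64 * (1794 * klE0) * (klE0 / Real.pi + 1 / klBetaMin))) ^ 2 / Real.sqrt (2 * (7 + 6047)) ^ 2 *
        max 1 (16 * Real.exp 1 ^ 9 * Real.sqrt (2 * (7 + 6047)) ^ 2 * klScaleZeroA0) *
        max 1 (4 * Real.exp 1 ^ 9 * Real.sqrt (2 * (7 + 6047)) ^ 4) * max 1 P.Klam⁻¹ ≤ Q.CE) :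
    KernelNormsV4 L M P Q β U μ K 0 := by
  intro p hp
  -- regime sizes
  obtain ⟨hL15, hβL, hM2, hβM, hβ3M, hMβ⟩ := scaleZero_regime_sizes (U := U) hβ hL hM
  have hβpos : 0 < β := lt_of_lt_of_le (by norm_num [klBetaMin]) hβ
  have hMpos : (0 : ℝ) < M := lt_of_lt_of_le hβpos hβM
  have hG : ∀ j, 0 ≤ R.Gfr j := hR.2.2
  have hκ₀ : (0 : ℝ) < Real.sqrt (2 * (7 + 6047)) := Real.sqrt_pos.2 (by norm_num)
  have hA0 : 0 < klScaleZeroA0 := klScaleZeroA0_pos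
  -- the sizes `A₀`, `kK`
  have hN4 : (((2 * (2 * M) : ℕ) : ℝ)) / β * klScaleZeroA0 = 4 * M * klScaleZeroA0 / β := by push_cast; ring
  have hrow : ∀ X, ∑ Y, ‖((hubbardGridSub L M β (2 * (2 * M))).transpose * hubbardCovAboveCT L M β μ 0 K klE0 *
      hubbardGridSub L M β (2 * (2 * M))) X Y‖ ≤ 4 * M * klScaleZeroA0 / β := fun X => by
    rw [← hN4]; exact rowSum_scaleZero_le_A0 hK hβ hβ3M X
  have hcol : ∀ Y, ∑ X, ‖((hubbardGridSub L M β (2 * (2 * M))).transpose * hubbardCovAboveCT L M β μ 0 K klE0 *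
      hubbardGridSub L M β (2 * (2 * M))) X Y‖ ≤ 4 * M * klScaleZeroA0 / β := fun Y => by
    rw [← hN4]; exact colSum_scaleZero_le_A0 hK hβ hβ3M Y
  have hkK := sum_norm_framePosKernel_le_linear_of_frameOK (L := L) hR hU.ne' (by rw [abs_of_pos hU]; exact hU1) hK
  -- `θ = klScaleZeroThetaC R · |U| ≤ 1/2`
  have hθ' : Real.exp 1 * (4 * M * klScaleZeroA0 / β) *
        normV (GridLeg (GridPoint L (2 * (2 * M)))) (Real.sqrt (2 * (7 + 6047))) (Real.sqrt (2 * (7 + 6047)))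
          ((fun m' : ℕ => if m' = 1 then |β| / (2 * (2 * M) : ℕ) * (klKappaFrameC R * |U|)
            else if m' = 2 then |U| * |β| / (2 * (2 * M) : ℕ) else 0)) /
        Real.sqrt (2 * (7 + 6047)) ^ 2 ≤ 1 / 2 := by
    rw [theta_scaleZero_eq (L := L) hβpos U klScaleZeroA0 (klKappaFrameC R * |U|)]
    have heq : Real.exp 1 * klScaleZeroA0 * (4 * Real.exp 1 ^ 4 * (klKappaFrameC R * |U|) +
        16 * Real.exp 1 ^ 8 * Real.sqrt (2 * (7 + 6047)) ^ 2 * |U|) = klScaleZeroThetaC R * U := by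
      rw [klScaleZeroThetaC, klScaleZeroCV, abs_of_pos hU]
      have he2 : Real.exp 2 = Real.exp 1 ^ 2 := by rw [← Real.exp_nat_mul]; norm_num
      rw [he2]
      field_simp
      ring
    rw [heq]
    exact hθ
  -- order by order
  have horder := klAnisoLegKernelNorm_zero_le_order hK hG hμ hκU hL15 hβ hβL hβM hM2 hMβ hkK hA0 hrow hcol hθ' hp
  refine horder.trans ?_
  -- the clause's right-hand side at `n = 0`
  have hrhs : Q.CE ^ p * epsCoupling P U 0 ^ (p - 1) * (2 : ℝ) ^ ((3 * (p : ℤ) - 5) * (0 : ℕ)) = Q.CE ^ p * (P.Klam * |U|) ^ (p - 1) := by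
    rw [epsCoupling]
    simp
  rw [hrhs]
  -- `B^p·Y·(X|U|)^{p-2}·|U| ≤ CE^p (Klam |U|)^{p-1}`
  have hfin := orderBound_le_CE_pow (U := U) hp
    (X := 16 * Real.exp 1 ^ 9 * Real.sqrt (2 * (7 + 6047)) ^ 2 * klScaleZeroA0)
    (Y := 4 * Real.exp 1 ^ 9 * Real.sqrt (2 * (7 + 6047)) ^ 4)
    (B := 2 * (Real.sqrt (2048 * (16 * Real.pi / klE0 + 1) *
            (4 * ((2 * Real.sqrt 2 / (2 / (Real.pi * ((22484224 / 9 + 7180 / 3 * sectorCircLineConst) + 1))) + 2) *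
              (2 * Real.sqrt 2 / (2 / (Real.pi * ((22484224 / 9 + 7180 / 3 * sectorCircLineConst) + 1))) + 2)) +
              16 * (1 / (2 / (Real.pi * ((22484224 / 9 + 7180 / 3 * sectorCircLineConst) + 1))) + 1) ^ 2)) *
          Real.sqrt (64 * (1794 * klE0) * (klE0 / Real.pi + 1 / klBetaMin))) ^ 2 / Real.sqrt (2 * (7 + 6047)) ^ 2)
    (by positivity) (by positivity) hP hQ
  refine le_trans (le_of_eq ?_) hfin
  rw [mul_pow, mul_pow, div_pow]
  ring

end Summit.HubbardSuperconductivity.HubbardSuperconductivity.Theorems.EngineV8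

end
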